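import Summits.BirchSwinnertonDyer.BirchSwinnertonDyer.Theorems.WildThreeRankOneBSDpOfGlobalDivisibilityStepL
import Literature.NumberTheory.EllipticCurves.Rank1Residual.Typed.KolyvaginCertificate
import Literature.NumberTheory.EllipticCurves.Rank1Residual.X10bMatarNekovarIndexBound
import Literature.NumberTheory.EllipticCurves.ShaRestriction
import Summits.BirchSwinnertonDyer.BirchSwinnertonDyer.Theorems.WildThreeRankOneBSDpOfHeegnerIndexCoprime
import HarnessLib

/-!
# CERTIFICATE currency (any odd `p`, any reduction type, `ρ̄_{E,p}` IRREDUCIBLE, non-CM): global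
# `p^s`-divisibility of the derived Heegner points to depth `ord_p ∏_ℓ c_ℓ(E) + s` on ONE frame + an index
# certificate `ord_p [E(K):ℤy_K] ≤ ord_p ∏_ℓ c_ℓ(E) + s` ⟹ `Ш(E/K)[p] = 0`, `Ш(E/ℚ)[p] = 0`, and — with
# `r_an ≤ 1` and `p ∤ #Ш_an(E)` — `BSD_p(E)`; the Σ-form («JET-PRODUCT») twin of bsd-jet's carrier
# certificates, NO twist, NO leaf, NO tower (route-free; seat `bsd-wall-utd-p3` gen 1; file 4)

Files 1–3 (`WildThreeRankOneBSDpOfGlobalDivisibility{,StepL,Class}.lean`, p540800/p542530/p544771) are in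
CLASS currency: the rank-one row's `BSD₃(E)` is paid by the rank-zero wild leaf of the twist. THIS file is
the CENSUS-BOOK (certificate) currency of referee A's rows `T-KOLY` / `T-JET`: per pair `(E, K)`, numerical
certificates (`ord_p I_K`, `ord_p ∏c_q`, `ord_p #Ш_an(E)`) replace the twist. What it adds to the tree's
bsd-jet kit (`JET.bsdp_of_carrierAddCertificate`, ONE carrier, MAX-form reading, McCallum with the `p`-adic
tower): the Σ-form over ALL carriers with the Manin slack, on Matar–Nekovář 2019 Thm. 0.7/§0.11 (IRREDUCIBLE
image, no tower, no reduction binder) — so it also serves the Cartan-normaliser-image rows that the census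
dossier lists as untyped at rank one (BLOCK-A dossier v1 §4 (u1)).

* §1 `upper_of_globalDivisibility_of_irr` — the receptacle of file 2 §5 with `ρ̄_{E,p}` IRREDUCIBLE + non-CM
  in place of onto (Matar–Nekovář needs no more): global divisibility on the frame `(Dt, H.β, ι)` to depth
  `ord_p ∏_ℓ c_ℓ(E) + s` (`hglob`, displayed) ⟹ `Upper.IndexUpperBoundLeAt W p K P s`.
* §2 `padicValNat_shaOrder_eq_zero_of_globalDivisibility_of_index_le` — + the index certificate
  `ord_p [E(K):ℤP] ≤ ord_p ∏_ℓ c_ℓ(E) + s` ⟹ `ord_p #Ш(E/K) = 0` and `ord_p #Ш(E/ℚ) = 0` (restriction,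
  `[K:ℚ] = 2` prime to `p`); `noPTorsion_sha_of_globalDivisibility_of_index_le` ⟹ `Ш(E/ℚ)[p] = 0`.
* §3 **`bsdp_of_globalDivisibility_of_index_le_of_shaAnUnit`** — + `r_an(E) ≤ 1` (GZK: `Ш(E/ℚ)` finite,
  rank = `r_an`) + `#Ш_an(E) = q` with `ord_p q = 0` ⟹ `BSDp W p` (`Typed.bsdp_of_shaAn_unit_of_noPTorsion`).
* §4 (appended) `partner_bsdp_of_globalDivisibility_of_index_le_of_shaAnUnit` — odd `p ∣ N_E`, `r_an(E) = 1`,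
  `d_K` odd, `L(E^{d_K},1) ≠ 0`: the same inputs also pay `BSDp Wd p` for any minimal model `Wd` of the
  rank-ZERO twist `E^{d_K}` (exact index + gen 0's converse peel `partner_bsdp_of_exactIndexManin_of_bsdp`).

PARTITION currency (census `blockA/BLOCK-A-index.md` T16/T17 READ, block A at `3`, referee A's book): the
rows whose only missing input is the displayed divisibility `hglob` at their certified datum (`i3 = t3`,
`Ш_an(E)` `3`-free; the slack `s = v₃(c) = 0` for the optimal curve) are JET-PRODUCT onto **4 227** (W 3 413 ·
T′ 590 · Gss2 224) + JET-PRODUCT normaliser-image **59** + JET-SINGLE normaliser-image **438** (one carrier: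
Σ = max) = **4 724** rank-one classes typed here as «J + print (MN19 0.7/§0.11, Kolyvagin, GZK)» in
certificate currency — NO rank-zero leaf, NO twin, NO tower. Classes closed: 0 (J is OPEN; in print
nowhere at `p ∣ N`); «beyond-print theorem»: NO. HONEST FRAMING: CONDITIONAL on `hglob` and on the named
facts (hypotheses); per pair; the numerical inputs are referee A's certificates, not the kernel's; BSD is
not proved for any curve by this file. No definition, no named fact, no `sorry`.

References: [Jetchev2008] Conj. 1.3, Thm. 1.4, Cor. 1.5 (p. 812); [MatarNekovar2019] Thm. 0.7 (p. 456),
§0.11 (p. 457); [McCallumLMS1991] §5 Lemma 5.1, Cor. 5.6; [GrossLMS1991] Prop. 2.1, §4 (4.1);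
[Miller2011LMS] Def. 1.1, §1; [SerreGaloisCohomology1997] I.§2.4; [JetchevSkinnerWan2017] §7.4.1.
-/

noncomputable section

open scoped Classical

set_option linter.dupNamespace false
set_option autoImplicit false

namespace Summit.BirchSwinnertonDyer.BirchSwinnertonDyer.Theorems.SchneiderFree.Exact

open WeierstrassCurve NumberField IsDedekindDomain Field
  Literature.NumberTheory.EllipticCurves
  Literature.NumberTheory.EllipticCurves.ModularForms
  Literature.NumberTheory.EllipticCurves.Rank1Residual
  Literature.NumberTheory.EllipticCurves.Rank1Residual.Typed
  Literature.NumberTheory.EllipticCurves.KrizLi2019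
  Summit.BirchSwinnertonDyer.Rank1Residual
  Summit.BirchSwinnertonDyer.Rank1Residual.X11b
  Summit.BirchSwinnertonDyer.Rank1Residual.X11b.Three

/-! ### §1 The receptacle under IRREDUCIBILITY (non-CM), any odd `p` -/

/-- **Global divisibility ⟹ the upper socket, `ρ̄_{E,p}` IRREDUCIBLE and `E` non-CM** (any odd `p`, any
reduction type). As file 2's `upper_of_globalDivisibility_of_surj` with the image hypothesis weakened to
what Matar–Nekovář 2019 Thm. 0.7/§0.11 needs (named fact `hMN`; hypothesis): `W/ℚ` globally minimal non-CM,
`E[p]` irreducible, `K` imaginary quadratic Heegner for `N_E` with `d_K ∉ {−3, −4}`, a Heegner point `P` of the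
datum `(Dt, H, ι)` of infinite order, and (`hglob`, DISPLAYED) every derived Heegner point on the frame
`(Dt, H.β, ι)` `p^{s′}`-divisible for all `s′ ≤ ord_p ∏_ℓ c_ℓ(E) + s` ⟹ `Upper.IndexUpperBoundLeAt W p K P s`.
[cite: MatarNekovar2019, Thm. 0.7 (p. 456) and §0.11 (p. 457)] [cite: McCallumLMS1991, §5 Cor. 5.6 (p. 310) and Lemma 5.1 (p. 303)]
[cite: Jetchev2008, Conj. 1.3 and (1) (p. 812)] -/
theorem upper_of_globalDivisibility_of_irr
    (hKo : ∀ (N : ℕ) [NeZero N] (W : WeierstrassCurve ℚ) (K : Type) [Field K] [NumberField K],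
      kolyvagin N W K)
    (hMN : MatarNekovar2019.thm07_padicValNat_card_sha_primary_add_le_of_globalDivisibility_of_irreducible)
    (W : WeierstrassCurve ℚ) [W.IsElliptic] [W.IsGloballyMinimal] [NeZero (W.conductorNorm ℤ)]
    (hCM : ¬ W.HasCM) (p : ℕ) [Fact p.Prime] (hp2 : p ≠ 2) (hirr : W.HasIrreducibleModPGaloisRep p)
    (K : Type) [Field K] [NumberField K] (hK : IsImaginaryQuadratic K)
    (h3 : NumberField.discr K ≠ -3) (h4 : NumberField.discr K ≠ -4)
    (hHH : SatisfiesHeegnerHypothesis (W.conductorNorm ℤ) K)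
    (Dt : ModularParametrizationData W (W.conductorNorm ℤ))
    (H : HeegnerDatum (W.conductorNorm ℤ) (NumberField.discr K)) (ι : K →+* ℂ)
    (P : (W.baseChange K).toAffine.Point)
    (hP : WeierstrassCurve.Affine.Point.map ι.toRatAlgHom P = heegnerPointComplex Dt H)
    (hnt : ¬ IsOfFinAddOrder P) {s : ℕ}
    (hglob : ∀ (s' : ℕ), s' ≤ padicValNat p W.tamagawaProduct + s →
      ∀ (n : ℕ) (d : KolyvaginHeegnerData Dt H.β ι n), Squarefree n →
        (∀ ℓ ∈ n.primeFactors, Zhang2014.IsKolyvaginPrime (W.conductorNorm ℤ) W K p ℓ ∧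
          s' ≤ Zhang2014.kolyvaginIndex W p ℓ) → Koly.PDiv d p s') :
    Upper.IndexUpperBoundLeAt W p K P s := by
  have hp : p.Prime := Fact.out
  obtain ⟨hrank, hfin⟩ := hKo (W.conductorNorm ℤ) W K hK hHH ⟨Dt, H, ι, hP⟩ hnt
  haveI : Finite (W.baseChange K).sha := hfin
  have hbot := torsionBy_eq_bot_of_isImaginaryQuadratic_of_hasIrreducibleModPGaloisRep W K hK hp hirr
  have hiv : ∀ x : (W.baseChange K).toAffine.Point, p • x = 0 → x = 0 := fun x hx ↦ by
    have hmem : x ∈ AddSubgroup.torsionBy (W.baseChange K).toAffine.Point ((p : ℕ) : ℤ) := by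
      rw [mem_torsionBy_iff, natCast_zsmul]
      exact hx
    rw [hbot] at hmem
    exact hmem
  obtain ⟨d₁⟩ := exists_kolyvaginHeegnerData_one
    (phi_heegnerTau_mem_singularModuliField_holds (W.conductorNorm ℤ) W K) hK Dt H.β ι H.dvd_sq_sub
  have hPd : d₁.toGeomPoints d₁.derivedPoint = toGeomPoints (W.baseChange K) P :=
    KolyvaginBottom.toGeomPoints_derivedPoint_one_eq
      (heegnerPointOfConductor_one_galoisConj_holds (W.conductorNorm ℤ) W K) hK hHH hP d₁ rfl
  haveI : Module.Finite ℤ (W.baseChange K).toAffine.Point := (W.baseChange K).module_finite_point_holds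
  obtain ⟨M₀, x₀, hx₀, hmax⟩ := exists_pow_smul_eq_and_forall_ne hnt (p := p) hp.two_le
  have hdiv : ∃ Q : (W.baseChange K).toAffine.Point, ((p ^ M₀ : ℕ) : ℤ) • Q = P :=
    ⟨x₀, by rw [natCast_zsmul]; exact hx₀⟩
  have hndiv : ¬ ∃ Q : (W.baseChange K).toAffine.Point, ((p ^ (M₀ + 1) : ℕ) : ℤ) • Q = P := by
    rintro ⟨Q, hQ⟩
    exact hmax Q (by rw [← natCast_zsmul]; exact hQ)
  have hle : padicValNat p (Nat.card (AddCommGroup.primaryComponent (W.baseChange K).sha p)) +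
      2 * (padicValNat p W.tamagawaProduct + s) ≤ 2 * M₀ :=
    hMN W hCM K hK h3 h4 hHH p hp2 hirr Dt H.β ι d₁ P hPd hnt M₀ hdiv hndiv
      (padicValNat p W.tamagawaProduct + s) (fun s' hs' n d hn hℓ ↦ hglob s' hs' n d hn hℓ)
  have hsha : padicValNat p (W.baseChange K).shaOrder =
      padicValNat p (Nat.card (AddCommGroup.primaryComponent (W.baseChange K).sha p)) :=
    Koly.padicValNat_shaOrder_eq (W.baseChange K) p
  haveI : Finite (AddCommGroup.torsion (W.baseChange K).toAffine.Point) :=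
    WeierstrassCurve.finite_torsion_point (W := W.baseChange K)
  obtain ⟨c, Q, hcQ, hcker⟩ := RankOne.exists_coord_of_mordellWeilRank_eq_one (W.baseChange K) hrank
  have hidx : padicValNat p (AddSubgroup.zmultiples P).index = M₀ :=
    Koly.padicValNat_index_zmultiples_eq_of_divisibility c Q hcQ hcker hiv P hdiv hndiv
  unfold Upper.IndexUpperBoundLeAt
  rw [hidx, hsha]
  omega

/-! ### §2 With the index certificate: `Ш(E/K)[p] = 0` and `Ш(E/ℚ)[p] = 0` -/

/-- **Global divisibility + the index certificate `ord_p [E(K):ℤP] ≤ ord_p ∏_ℓ c_ℓ(E) + s` ⟹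
`ord_p #Ш(E/K) = 0` and `ord_p #Ш(E/ℚ) = 0`** (data as in §1): §1 and the arithmetic of the sockets
(`indexBounds_of_upper_of_index_le`) kill `ord_p #Ш(E/K)`; the restriction `Ш(E/ℚ) → Ш(E/K)` has kernel
killed by `[K:ℚ] = 2`, prime to `p` (`padicValNat_shaOrder_le_baseChange_of_odd`). CONDITIONAL on `hglob`,
`hMN`, `hKo`. [cite: Jetchev2008, Cor. 1.5 and (1) (p. 812)] [cite: MatarNekovar2019, Thm. 0.7 (p. 456) and §0.11 (p. 457)]
[cite: SerreGaloisCohomology1997, I.§2.4 Cor. to Prop. 9] -/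
theorem padicValNat_shaOrder_eq_zero_of_globalDivisibility_of_index_le
    (hKo : ∀ (N : ℕ) [NeZero N] (W : WeierstrassCurve ℚ) (K : Type) [Field K] [NumberField K],
      kolyvagin N W K)
    (hMN : MatarNekovar2019.thm07_padicValNat_card_sha_primary_add_le_of_globalDivisibility_of_irreducible)
    (W : WeierstrassCurve ℚ) [W.IsElliptic] [W.IsGloballyMinimal] [NeZero (W.conductorNorm ℤ)]
    (hCM : ¬ W.HasCM) (p : ℕ) [Fact p.Prime] (hp2 : p ≠ 2) (hirr : W.HasIrreducibleModPGaloisRep p)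
    (K : Type) [Field K] [NumberField K] (hK : IsImaginaryQuadratic K)
    (h3 : NumberField.discr K ≠ -3) (h4 : NumberField.discr K ≠ -4)
    (hHH : SatisfiesHeegnerHypothesis (W.conductorNorm ℤ) K)
    (Dt : ModularParametrizationData W (W.conductorNorm ℤ))
    (H : HeegnerDatum (W.conductorNorm ℤ) (NumberField.discr K)) (ι : K →+* ℂ)
    (P : (W.baseChange K).toAffine.Point)
    (hP : WeierstrassCurve.Affine.Point.map ι.toRatAlgHom P = heegnerPointComplex Dt H)
    (hnt : ¬ IsOfFinAddOrder P) {s : ℕ}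
    (hglob : ∀ (s' : ℕ), s' ≤ padicValNat p W.tamagawaProduct + s →
      ∀ (n : ℕ) (d : KolyvaginHeegnerData Dt H.β ι n), Squarefree n →
        (∀ ℓ ∈ n.primeFactors, Zhang2014.IsKolyvaginPrime (W.conductorNorm ℤ) W K p ℓ ∧
          s' ≤ Zhang2014.kolyvaginIndex W p ℓ) → Koly.PDiv d p s')
    (hI : padicValNat p (AddSubgroup.zmultiples P).index ≤ padicValNat p W.tamagawaProduct + s) :
    padicValNat p (W.baseChange K).shaOrder = 0 ∧ padicValNat p W.shaOrder = 0 := by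
  have hup : Upper.IndexUpperBoundLeAt W p K P s :=
    upper_of_globalDivisibility_of_irr hKo hMN W hCM p hp2 hirr K hK h3 h4 hHH Dt H ι P hP hnt hglob
  obtain ⟨hK0, -, -⟩ := indexBounds_of_upper_of_index_le hup hI
  obtain ⟨-, hfinK⟩ := hKo (W.conductorNorm ℤ) W K hK hHH ⟨Dt, H, ι, hP⟩ hnt
  have hfin : W.ShaFinite := shaFinite_of_baseChange W K hfinK
  have hle : padicValNat p W.shaOrder ≤ padicValNat p (Nat.card (W.baseChange K).sha) :=
    padicValNat_shaOrder_le_baseChange_of_odd W K hK p hp2 hfin hfinK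
  have hK0' : padicValNat p (Nat.card (W.baseChange K).sha) = 0 := hK0
  exact ⟨hK0, by omega⟩

/-- **… hence `Ш(E/ℚ)[p] = 0`** (Lagrange; `Ш(E/ℚ)` finite by Kolyvagin + restriction). CONDITIONAL on `hglob`,
`hMN`, `hKo`. [cite: Jetchev2008, Cor. 1.5 (p. 812)] [cite: Miller2011LMS, Def. 1.1] -/
theorem noPTorsion_sha_of_globalDivisibility_of_index_le
    (hKo : ∀ (N : ℕ) [NeZero N] (W : WeierstrassCurve ℚ) (K : Type) [Field K] [NumberField K],
      kolyvagin N W K)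
    (hMN : MatarNekovar2019.thm07_padicValNat_card_sha_primary_add_le_of_globalDivisibility_of_irreducible)
    (W : WeierstrassCurve ℚ) [W.IsElliptic] [W.IsGloballyMinimal] [NeZero (W.conductorNorm ℤ)]
    (hCM : ¬ W.HasCM) (p : ℕ) [Fact p.Prime] (hp2 : p ≠ 2) (hirr : W.HasIrreducibleModPGaloisRep p)
    (K : Type) [Field K] [NumberField K] (hK : IsImaginaryQuadratic K)
    (h3 : NumberField.discr K ≠ -3) (h4 : NumberField.discr K ≠ -4)
    (hHH : SatisfiesHeegnerHypothesis (W.conductorNorm ℤ) K)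
    (Dt : ModularParametrizationData W (W.conductorNorm ℤ))
    (H : HeegnerDatum (W.conductorNorm ℤ) (NumberField.discr K)) (ι : K →+* ℂ)
    (P : (W.baseChange K).toAffine.Point)
    (hP : WeierstrassCurve.Affine.Point.map ι.toRatAlgHom P = heegnerPointComplex Dt H)
    (hnt : ¬ IsOfFinAddOrder P) {s : ℕ}
    (hglob : ∀ (s' : ℕ), s' ≤ padicValNat p W.tamagawaProduct + s →
      ∀ (n : ℕ) (d : KolyvaginHeegnerData Dt H.β ι n), Squarefree n →
        (∀ ℓ ∈ n.primeFactors, Zhang2014.IsKolyvaginPrime (W.conductorNorm ℤ) W K p ℓ ∧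
          s' ≤ Zhang2014.kolyvaginIndex W p ℓ) → Koly.PDiv d p s')
    (hI : padicValNat p (AddSubgroup.zmultiples P).index ≤ padicValNat p W.tamagawaProduct + s) :
    ∀ x : W.sha, (p : ℤ) • x = 0 → x = 0 := by
  obtain ⟨-, hfinK⟩ := hKo (W.conductorNorm ℤ) W K hK hHH ⟨Dt, H, ι, hP⟩ hnt
  have hfin : W.ShaFinite := shaFinite_of_baseChange W K hfinK
  exact noPTorsion_of_padicValNat_shaOrder_eq_zero W p hfin
    (padicValNat_shaOrder_eq_zero_of_globalDivisibility_of_index_le hKo hMN W hCM p hp2 hirr K hK h3 h4 hHH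
      Dt H ι P hP hnt hglob hI).2

/-! ### §3 `BSD_p(E)` in analytic rank `≤ 1` from the two certificates and global divisibility -/

/-- **JET-PRODUCT certificate theorem (Σ-form, any odd `p`, any reduction type, irreducible non-CM image).**
For `W/ℚ` globally minimal non-CM with `E[p]` irreducible and `r_an(E) ≤ 1`, `K` imaginary quadratic Heegner
for `N_E` with `d_K ∉ {−3, −4}`, a Heegner point `P` of the datum `(Dt, H, ι)` of infinite order, and the two
CERTIFICATES (i) `ord_p [E(K):ℤP] ≤ ord_p ∏_ℓ c_ℓ(E) + s` (the census's `i_p = t_p` at `s = v_p(c) = 0`),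
(ii) `#Ш_an(E) = q` with `ord_p q = 0`: global `p^{s′}`-divisibility of the derived Heegner points on the frame
to depth `ord_p ∏_ℓ c_ℓ(E) + s` (`hglob`, DISPLAYED — Jetchev Conj. 1.3 «≥», Σ-form, point currency) +
Matar–Nekovář 0.7/§0.11 (named) + Kolyvagin (named) + GZK (named) ⟹ `BSDp W p`. NO twist, NO rank-zero leaf,
NO `p`-adic tower. CONDITIONAL; per pair; books nothing by itself.
[cite: Jetchev2008, Conj. 1.3, Thm. 1.4 and Cor. 1.5 (p. 812)] [cite: MatarNekovar2019, Thm. 0.7 (p. 456) and §0.11 (p. 457)]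
[cite: Miller2011LMS, §1 and Def. 1.1] [cite: GrossLMS1991, Thm. 1.3 and Prop. 2.1] -/
theorem bsdp_of_globalDivisibility_of_index_le_of_shaAnUnit
    (hKo : ∀ (N : ℕ) [NeZero N] (W : WeierstrassCurve ℚ) (K : Type) [Field K] [NumberField K],
      kolyvagin N W K)
    (hMN : MatarNekovar2019.thm07_padicValNat_card_sha_primary_add_le_of_globalDivisibility_of_irreducible)
    (hGZK : rank_eq_analyticRank_of_analyticRank_le_one)
    (W : WeierstrassCurve ℚ) [W.IsElliptic] [W.IsGloballyMinimal] [NeZero (W.conductorNorm ℤ)]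
    (hCM : ¬ W.HasCM) (p : ℕ) [Fact p.Prime] (hp2 : p ≠ 2) (hirr : W.HasIrreducibleModPGaloisRep p)
    (hr : W.analyticRank ≤ 1)
    (K : Type) [Field K] [NumberField K] (hK : IsImaginaryQuadratic K)
    (h3 : NumberField.discr K ≠ -3) (h4 : NumberField.discr K ≠ -4)
    (hHH : SatisfiesHeegnerHypothesis (W.conductorNorm ℤ) K)
    (Dt : ModularParametrizationData W (W.conductorNorm ℤ))
    (H : HeegnerDatum (W.conductorNorm ℤ) (NumberField.discr K)) (ι : K →+* ℂ)
    (P : (W.baseChange K).toAffine.Point)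
    (hP : WeierstrassCurve.Affine.Point.map ι.toRatAlgHom P = heegnerPointComplex Dt H)
    (hnt : ¬ IsOfFinAddOrder P) {s : ℕ}
    (hglob : ∀ (s' : ℕ), s' ≤ padicValNat p W.tamagawaProduct + s →
      ∀ (n : ℕ) (d : KolyvaginHeegnerData Dt H.β ι n), Squarefree n →
        (∀ ℓ ∈ n.primeFactors, Zhang2014.IsKolyvaginPrime (W.conductorNorm ℤ) W K p ℓ ∧
          s' ≤ Zhang2014.kolyvaginIndex W p ℓ) → Koly.PDiv d p s')
    (hI : padicValNat p (AddSubgroup.zmultiples P).index ≤ padicValNat p W.tamagawaProduct + s)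
    {q : ℚ} (hq : shaAn W = (q : ℂ)) (hv : padicValRat p q = 0) :
    BSDp W p :=
  bsdp_of_shaAn_unit_of_noPTorsion W p hGZK hr hq hv
    (noPTorsion_sha_of_globalDivisibility_of_index_le hKo hMN W hCM p hp2 hirr K hK h3 h4 hHH Dt H ι P hP
      hnt hglob hI)

/-! ### §4 (appended, gen 1) The rank-ZERO twist from the rank-one side: J + certificates ⟹ `BSD_p(E^{d_K})` -/

/-- **J + the two certificates on the rank-ONE curve pay `BSD_p` of the rank-ZERO twist `E^{d_K}`** (odd
`p ∣ N_E`, `ρ̄_{E,p}` irreducible, non-CM). Data as in §3 with `r_an(E) = 1`, `d_K` odd, `d_K ≠ −3`,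
`L(E^{d_K},1) ≠ 0`, `Wd` any globally minimal model of `E^{d_K}`, the slack `s = v_p(c(Dt))`: global
divisibility (`hglob`, displayed) + the index certificate give the EXACT index at slack `v_p(c)` (§1 +
`indexBounds_of_upper_of_index_le`), §3 gives `BSDp W p` from `#Ш_an(E)` a `p`-adic unit, and gen 0's converse
peel `partner_bsdp_of_exactIndexManin_of_bsdp` (the joint halves are symmetric in the pair) gives `BSDp Wd p` —
a rank-zero row of the twist (at `p = 3 ∣ N_E` wild, again a non-CM wild row) paid by the Heegner side of
its rank-one partner, with ONE research input. CONDITIONAL; per datum; books nothing by itself.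
[cite: Jetchev2008, Conj. 1.3 and Cor. 1.5 (p. 812)] [cite: GrossZagier1986, Thm. I.(6.3) and (7.3)]
[cite: MatarNekovar2019, Thm. 0.7 (p. 456) and §0.11 (p. 457)] [cite: Miller2011LMS, Def. 1.1] -/
theorem partner_bsdp_of_globalDivisibility_of_index_le_of_shaAnUnit
    (hGZ : ∀ (N : ℕ) [NeZero N] (W : WeierstrassCurve ℚ) (K : Type) [Field K] [NumberField K],
      gross_zagier N W K)
    (hKo : ∀ (N : ℕ) [NeZero N] (W : WeierstrassCurve ℚ) (K : Type) [Field K] [NumberField K],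
      kolyvagin N W K)
    (hGZK : rank_eq_analyticRank_of_analyticRank_le_one) (hmod : hasEntireLFunction_rat)
    (hGZ73 : GrossZagier1986_thm_I_7_3)
    (hMN : MatarNekovar2019.thm07_padicValNat_card_sha_primary_add_le_of_globalDivisibility_of_irreducible)
    (W : WeierstrassCurve ℚ) [W.IsElliptic] [W.IsGloballyMinimal] [NeZero (W.conductorNorm ℤ)]
    (hCM : ¬ W.HasCM) (p : ℕ) [Fact p.Prime] (hp2 : p ≠ 2) (hirr : W.HasIrreducibleModPGaloisRep p)
    (hr : W.analyticRank = 1) (hpN : p ∣ W.conductorNorm ℤ)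
    (K : Type) [Field K] [NumberField K] (hK : IsImaginaryQuadratic K) (hodd : Odd (NumberField.discr K))
    (h3 : NumberField.discr K ≠ -3) (hHH : SatisfiesHeegnerHypothesis (W.conductorNorm ℤ) K)
    (Dt : ModularParametrizationData W (W.conductorNorm ℤ))
    (H : HeegnerDatum (W.conductorNorm ℤ) (NumberField.discr K)) (ι : K →+* ℂ)
    (P : (W.baseChange K).toAffine.Point) (Wd : WeierstrassCurve ℚ) [Wd.IsElliptic] [Wd.IsGloballyMinimal]
    (hLd : (W.quadraticTwist (NumberField.discr K : ℚ)).entireLFunction 1 ≠ 0)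
    (hP : WeierstrassCurve.Affine.Point.map ι.toRatAlgHom P = heegnerPointComplex Dt H)
    (hC : ∃ C : VariableChange ℚ, C • W.quadraticTwist (NumberField.discr K : ℚ) = Wd)
    (hglob : ∀ (s' : ℕ), s' ≤ padicValNat p W.tamagawaProduct + padicValNat p Dt.c.natAbs →
      ∀ (n : ℕ) (d : KolyvaginHeegnerData Dt H.β ι n), Squarefree n →
        (∀ ℓ ∈ n.primeFactors, Zhang2014.IsKolyvaginPrime (W.conductorNorm ℤ) W K p ℓ ∧
          s' ≤ Zhang2014.kolyvaginIndex W p ℓ) → Koly.PDiv d p s')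
    (hI : padicValNat p (AddSubgroup.zmultiples P).index ≤
      padicValNat p W.tamagawaProduct + padicValNat p Dt.c.natAbs)
    {q : ℚ} (hq : shaAn W = (q : ℂ)) (hv : padicValRat p q = 0) :
    BSDp Wd p := by
  have h4 : NumberField.discr K ≠ -4 := by
    intro h
    rw [h] at hodd
    exact (Int.not_odd_iff_even.mpr ⟨-2, by norm_num⟩) hodd
  have hw : ¬ p ∣ Units.torsionOrder K :=
    (X11b.Three.not_dvd_discr_and_not_dvd_torsionOrder_of_heegner hK hHH hp2 hpN).2
  -- the Heegner point is non-torsion (Gross–Zagier)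
  have hL0 : W.entireLFunction 1 = 0 := entireLFunction_one_eq_zero_of_analyticRank_eq_one hr
  obtain ⟨-, hderiv⟩ := leadingLCoeff_eq_deriv_of_analyticRank_eq_one hr
  have hLK : LDerivEK W K ≠ 0 := by
    rw [lDerivEK_eq_deriv_mul W K hmod hL0]; exact mul_ne_zero hderiv hLd
  have hnt : ¬ IsOfFinAddOrder P :=
    (lDerivEK_ne_zero_iff_not_isOfFinAddOrder W (W.conductorNorm ℤ) K (hGZ _ W K) hK hHH
      ⟨Dt, H, ι, hP⟩).mp hLK
  -- the exact index at slack `v_p(c)` and `BSDp W p` from the certificates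
  have hup : Upper.IndexUpperBoundLeAt W p K P (padicValNat p Dt.c.natAbs) :=
    upper_of_globalDivisibility_of_irr hKo hMN W hCM p hp2 hirr K hK h3 h4 hHH Dt H ι P hP hnt hglob
  obtain ⟨-, hlo, -⟩ := indexBounds_of_upper_of_index_le hup hI
  have hW : BSDp W p :=
    bsdp_of_globalDivisibility_of_index_le_of_shaAnUnit hKo hMN hGZK W hCM p hp2 hirr hr.le K hK h3 h4 hHH
      Dt H ι P hP hnt hglob hI hq hv
  -- the converse peel (gen 0, §4 of `WildThreeRankOneBSDpOfHeegnerIndexCoprime`)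
  exact partner_bsdp_of_exactIndexManin_of_bsdp hGZ hKo hGZK hmod hGZ73 W p (W.conductorNorm ℤ) K Dt H ι P Wd
    hr rfl hpN hK hodd hw hHH hLd hP hC hp2 hlo hup hW

end Summit.BirchSwinnertonDyer.BirchSwinnertonDyer.Theorems.SchneiderFree.Exact

end
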